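import Mathlib
import Summits.NavierStokesRegularity.NavierStokesRegularity.Theorems.TaoLadderRungTwoFlatNearBehindAprioriSharp
import HarnessLib

/-!
# The INTERFACE SHELL of the near/behind step: pointwise field differences and the level-fed top-edge input (D16) (theory-1 g48 numT61 design P-61a, L-61a/L-61b; helper for the K_A♭ parent item
  stmt-NavierStokesRegularity-22987 `FlatGapCertificatesV2`, child 2A `GradedAdiabaticWakeA` of route TaoLadderRungTwoFlat;
  cell harvest/h2-tao-ladder, p1 g24; LADDER §60–§61)

The composed near/behind step of record (`HopTube.tubeStepNearBehindR54_of_schedule_halo`) carries the in-hop deviation at the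
INTERFACE shell `1−K` (both species) as a hypothesis `hcoreIn`. theory-1's numT61 (INTERFACE-61) shows that this deviation is a
two-variable bootstrap quantity fed by exactly three things: its section datum, the near→core PUMP at the bottom edge (the near
level at the top near shell `−K`), and the carrier deviation ONE SHELL DEEPER (`2−K`). This module supplies the pointwise
ingredients of that loop for two exact graded mirror flows `S` (hop flow) and `W` (reference flow), `u := S − W`:

* `quadTermOn_carrier_sub`, `abs_quadTermOn_carrier_sub_le` — the carrier field difference at shell `n ≤ 0`:
  `|Q₀,ₙ(S) − Q₀,ₙ(W)| ≤ ν(2M + ν + ε(M + R)) + εMR + ((2+ε)M·B + B² + εMR + εRB)` from `|u₁(n−1)| ≤ ν` (pump source),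
  `|u₀(n)| ≤ R`, `|u₁(n)| ≤ B`, templates `≤ M`;
* `quadTermOn_bond_sub`, `abs_quadTermOn_bond_sub_le` — the bond field difference at shell `n ≤ 0`:
  `|Q₁,ₙ(S) − Q₁,ₙ(W)| ≤ (M + M₂ + R + ρ)B + (1+2ε)MR + εR² + (M + 2εM₂)ρ + ερ²` from `|u₀(n+1)| ≤ ρ`, `|W₀(n+1)| ≤ M₂`;
* `edgeInput_le_level` — the near block's edge input with the TOP bond read from the near LEVEL (theory-1 D16): the co-moving
  weight `e^{θ(P − n_e)}` cancels the level's growth, so the top summand is `c̄·r·(2V̄ + ε·r·√(2V̄) + (1+ε)·M·r)`;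
(The one-hop INTEGRATION of the two interface deviations is `…TaoLadderRungTwoFlatInterfaceTransient`.)

HONEST FRAMING: algebra and one-variable calculus about a MODEL lattice nonlinearity (Tao 2016 §4 vocabulary on `S♭`, graded
mirror table, `m = 2`); every level is a HYPOTHESIS; nothing certified about any orbit; no item closed; nothing about the
Navier–Stokes equations.
-/

noncomputable section

-- the sub-problem namespace repeats the summit name by design (D-0017)
set_option linter.dupNamespace false

namespace Summit.NavierStokesRegularity.NavierStokesRegularity.Theorems

open Set Finset Literature.Analysis.FluidPDE Literature.Analysis.FluidPDE.TaoCascade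

namespace MirrorPulse

/-! ### Pointwise field differences at the interface shell -/

/-- **Carrier field difference at shell `n`** (graded mirror table, `u = S − W`):
`Q₀,ₙ(S) − Q₀,ₙ(W) = c_{n−1}·[u₁'(2W₁' + u₁') + ε(u₀W₁' + W₀u₁' + u₀u₁')] − c_n·[u₁(2W₁ + u₁) + ε(u₀W₁ + W₀u₁ + u₀u₁)]`
(`'` = shell `n−1`, unprimed = shell `n`, `W₀ = W 0 n`, `u₀ = u 0 n`).
[cite: Tao2016AveragedNS, §4 (4.8) (the quadratic nonlinearity); route TaoLadderRungTwoFlat, posited table (cell LADDER §61)] -/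
theorem quadTermOn_carrier_sub (ε₀ ε : ℝ) (S W : Fin 2 → ℤ → ℝ → ℝ) (n : ℤ) (s : ℝ) :
    quadTermOn shiftSetFlat ε₀ (mirrorTable ε ε) S 0 n s - quadTermOn shiftSetFlat ε₀ (mirrorTable ε ε) W 0 n s
      = clock ε₀ (n - 1) * ((S - W) 1 (n - 1) s * (2 * W 1 (n - 1) s + (S - W) 1 (n - 1) s)
          + ε * ((S - W) 0 n s * W 1 (n - 1) s + W 0 n s * (S - W) 1 (n - 1) s
            + (S - W) 0 n s * (S - W) 1 (n - 1) s))
        - clock ε₀ n * ((S - W) 1 n s * (2 * W 1 n s + (S - W) 1 n s)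
          + ε * ((S - W) 0 n s * W 1 n s + W 0 n s * (S - W) 1 n s + (S - W) 0 n s * (S - W) 1 n s)) := by
  rw [MirrorField.quadTermOn_mirrorTable_carrier, MirrorField.quadTermOn_mirrorTable_carrier]
  have h1 : (1 + ε₀) ^ ((5 : ℝ) * (n - 1) / 2) = clock ε₀ (n - 1) := by unfold clock; push_cast; ring_nf
  have h2 : (1 + ε₀) ^ ((5 : ℝ) * n / 2) = clock ε₀ n := rfl
  rw [h1, h2]
  simp only [Pi.sub_apply]
  ring

/-- **Carrier field difference bound at shell `n ≤ 0`** (`0 ≤ ε`, `0 ≤ ε₀`, so both clocks are `≤ 1`): with the pump source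
`|u₁(n−1)| ≤ ν`, interface levels `|u₀(n)| ≤ R`, `|u₁(n)| ≤ B` and templates `|W₁(n−1)|, |W₀(n)|, |W₁(n)| ≤ M`,
`|Q₀,ₙ(S) − Q₀,ₙ(W)| ≤ ν(2M + ν + ε(M + R)) + εMR + ((2+ε)MB + B² + εMR + εRB)`.
[cite: Tao2016AveragedNS, §4 (4.8); route TaoLadderRungTwoFlat, L-61a (cell LADDER §61, numT61 §3)] -/
theorem abs_quadTermOn_carrier_sub_le {ε₀ ε : ℝ} (hε : 0 ≤ ε) (hε₀ : 0 ≤ ε₀) {S W : Fin 2 → ℤ → ℝ → ℝ} {n : ℤ}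
    (hn : n ≤ 0) {s M ν R B : ℝ}
    (hW1' : |W 1 (n - 1) s| ≤ M) (hW0 : |W 0 n s| ≤ M) (hW1 : |W 1 n s| ≤ M)
    (hν : |(S - W) 1 (n - 1) s| ≤ ν) (hR : |(S - W) 0 n s| ≤ R) (hB : |(S - W) 1 n s| ≤ B) :
    |quadTermOn shiftSetFlat ε₀ (mirrorTable ε ε) S 0 n s - quadTermOn shiftSetFlat ε₀ (mirrorTable ε ε) W 0 n s|
      ≤ ν * (2 * M + ν + ε * (M + R)) + ε * M * R + ((2 + ε) * M * B + B ^ 2 + ε * M * R + ε * R * B) := by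
  rw [quadTermOn_carrier_sub]
  have hM0 : 0 ≤ M := (abs_nonneg _).trans hW0
  have hν0 : 0 ≤ ν := (abs_nonneg _).trans hν
  have hR0 : 0 ≤ R := (abs_nonneg _).trans hR
  have hB0 : 0 ≤ B := (abs_nonneg _).trans hB
  have hc' : clock ε₀ (n - 1) ≤ 1 := HopTube.clock_le_one_of_nonpos hε₀ (by omega)
  have hc : clock ε₀ n ≤ 1 := HopTube.clock_le_one_of_nonpos hε₀ hn
  have hc'0 : 0 ≤ clock ε₀ (n - 1) := clock_nonneg (by linarith) _
  have hc0 : 0 ≤ clock ε₀ n := clock_nonneg (by linarith) _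
  -- the lower group
  set X := (S - W) 1 (n - 1) s * (2 * W 1 (n - 1) s + (S - W) 1 (n - 1) s)
      + ε * ((S - W) 0 n s * W 1 (n - 1) s + W 0 n s * (S - W) 1 (n - 1) s
        + (S - W) 0 n s * (S - W) 1 (n - 1) s) with hX
  -- the upper group
  set Y := (S - W) 1 n s * (2 * W 1 n s + (S - W) 1 n s)
      + ε * ((S - W) 0 n s * W 1 n s + W 0 n s * (S - W) 1 n s + (S - W) 0 n s * (S - W) 1 n s) with hY
  have hXle : |X| ≤ ν * (2 * M + ν + ε * (M + R)) + ε * M * R := by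
    have h1 : |(S - W) 1 (n - 1) s * (2 * W 1 (n - 1) s + (S - W) 1 (n - 1) s)| ≤ ν * (2 * M + ν) := by
      have hq : |2 * W 1 (n - 1) s + (S - W) 1 (n - 1) s| ≤ 2 * M + ν := by
        calc |2 * W 1 (n - 1) s + (S - W) 1 (n - 1) s| ≤ |2 * W 1 (n - 1) s| + |(S - W) 1 (n - 1) s| :=
            abs_add_le _ _
          _ ≤ 2 * M + ν := by rw [abs_mul, abs_two]; exact add_le_add (by linarith) hν
      rw [abs_mul]; exact mul_le_mul hν hq (abs_nonneg _) hν0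
    have h2 : |(S - W) 0 n s * W 1 (n - 1) s| ≤ R * M := (by rw [abs_mul]; exact mul_le_mul hR hW1' (abs_nonneg _) ((abs_nonneg _).trans hR))
    have h3 : |W 0 n s * (S - W) 1 (n - 1) s| ≤ M * ν := (by rw [abs_mul]; exact mul_le_mul hW0 hν (abs_nonneg _) ((abs_nonneg _).trans hW0))
    have h4 : |(S - W) 0 n s * (S - W) 1 (n - 1) s| ≤ R * ν := (by rw [abs_mul]; exact mul_le_mul hR hν (abs_nonneg _) ((abs_nonneg _).trans hR))
    have h5 : |ε * ((S - W) 0 n s * W 1 (n - 1) s + W 0 n s * (S - W) 1 (n - 1) s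
        + (S - W) 0 n s * (S - W) 1 (n - 1) s)| ≤ ε * (R * M + M * ν + R * ν) := by
      rw [abs_mul, abs_of_nonneg hε]
      refine mul_le_mul_of_nonneg_left ?_ hε
      calc _ ≤ |(S - W) 0 n s * W 1 (n - 1) s + W 0 n s * (S - W) 1 (n - 1) s|
              + |(S - W) 0 n s * (S - W) 1 (n - 1) s| := abs_add_le _ _
        _ ≤ (|(S - W) 0 n s * W 1 (n - 1) s| + |W 0 n s * (S - W) 1 (n - 1) s|)
              + |(S - W) 0 n s * (S - W) 1 (n - 1) s| := by gcongr; exact abs_add_le _ _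
        _ ≤ (R * M + M * ν) + R * ν := by gcongr
    calc |X| ≤ |(S - W) 1 (n - 1) s * (2 * W 1 (n - 1) s + (S - W) 1 (n - 1) s)|
          + |ε * ((S - W) 0 n s * W 1 (n - 1) s + W 0 n s * (S - W) 1 (n - 1) s
            + (S - W) 0 n s * (S - W) 1 (n - 1) s)| := abs_add_le _ _
      _ ≤ ν * (2 * M + ν) + ε * (R * M + M * ν + R * ν) := add_le_add h1 h5
      _ = ν * (2 * M + ν + ε * (M + R)) + ε * M * R := by ring
  have hYle : |Y| ≤ (2 + ε) * M * B + B ^ 2 + ε * M * R + ε * R * B := by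
    have h1 : |(S - W) 1 n s * (2 * W 1 n s + (S - W) 1 n s)| ≤ B * (2 * M + B) := by
      have hq : |2 * W 1 n s + (S - W) 1 n s| ≤ 2 * M + B := by
        calc |2 * W 1 n s + (S - W) 1 n s| ≤ |2 * W 1 n s| + |(S - W) 1 n s| := abs_add_le _ _
          _ ≤ 2 * M + B := by rw [abs_mul, abs_two]; exact add_le_add (by linarith) hB
      rw [abs_mul]; exact mul_le_mul hB hq (abs_nonneg _) hB0
    have h2 : |(S - W) 0 n s * W 1 n s| ≤ R * M := (by rw [abs_mul]; exact mul_le_mul hR hW1 (abs_nonneg _) ((abs_nonneg _).trans hR))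
    have h3 : |W 0 n s * (S - W) 1 n s| ≤ M * B := (by rw [abs_mul]; exact mul_le_mul hW0 hB (abs_nonneg _) ((abs_nonneg _).trans hW0))
    have h4 : |(S - W) 0 n s * (S - W) 1 n s| ≤ R * B := (by rw [abs_mul]; exact mul_le_mul hR hB (abs_nonneg _) ((abs_nonneg _).trans hR))
    have h5 : |ε * ((S - W) 0 n s * W 1 n s + W 0 n s * (S - W) 1 n s + (S - W) 0 n s * (S - W) 1 n s)|
        ≤ ε * (R * M + M * B + R * B) := by
      rw [abs_mul, abs_of_nonneg hε]
      refine mul_le_mul_of_nonneg_left ?_ hε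
      calc _ ≤ |(S - W) 0 n s * W 1 n s + W 0 n s * (S - W) 1 n s| + |(S - W) 0 n s * (S - W) 1 n s| :=
            abs_add_le _ _
        _ ≤ (|(S - W) 0 n s * W 1 n s| + |W 0 n s * (S - W) 1 n s|) + |(S - W) 0 n s * (S - W) 1 n s| := by
            gcongr; exact abs_add_le _ _
        _ ≤ (R * M + M * B) + R * B := by gcongr
    calc |Y| ≤ |(S - W) 1 n s * (2 * W 1 n s + (S - W) 1 n s)|
          + |ε * ((S - W) 0 n s * W 1 n s + W 0 n s * (S - W) 1 n s + (S - W) 0 n s * (S - W) 1 n s)| :=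
          abs_add_le _ _
      _ ≤ B * (2 * M + B) + ε * (R * M + M * B + R * B) := add_le_add h1 h5
      _ = (2 + ε) * M * B + B ^ 2 + ε * M * R + ε * R * B := by ring
  have hX0 : 0 ≤ |X| := abs_nonneg _
  have hY0 : 0 ≤ |Y| := abs_nonneg _
  calc |clock ε₀ (n - 1) * X - clock ε₀ n * Y| ≤ |clock ε₀ (n - 1) * X| + |clock ε₀ n * Y| := abs_sub _ _
    _ = clock ε₀ (n - 1) * |X| + clock ε₀ n * |Y| := by
        rw [abs_mul, abs_mul, abs_of_nonneg hc'0, abs_of_nonneg hc0]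
    _ ≤ 1 * |X| + 1 * |Y| := add_le_add (mul_le_mul_of_nonneg_right hc' hX0) (mul_le_mul_of_nonneg_right hc hY0)
    _ ≤ _ := by rw [one_mul, one_mul]; exact add_le_add hXle hYle

/-- **Bond field difference at shell `n`** (graded mirror table, `u = S − W`; `⁺` = shell `n+1`):
`Q₁,ₙ(S) − Q₁,ₙ(W) = c_n·[(u₀W₁ + W₀u₁ + u₀u₁) + ε·u₀(2W₀ + u₀) − (u₀⁺W₁ + W₀⁺u₁ + u₀⁺u₁) − ε·u₀⁺(2W₀⁺ + u₀⁺)]`.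
[cite: Tao2016AveragedNS, §4 (4.8) (the quadratic nonlinearity); route TaoLadderRungTwoFlat, posited table (cell LADDER §61)] -/
theorem quadTermOn_bond_sub (ε₀ ε : ℝ) (S W : Fin 2 → ℤ → ℝ → ℝ) (n : ℤ) (s : ℝ) :
    quadTermOn shiftSetFlat ε₀ (mirrorTable ε ε) S 1 n s - quadTermOn shiftSetFlat ε₀ (mirrorTable ε ε) W 1 n s
      = clock ε₀ n * (((S - W) 0 n s * W 1 n s + W 0 n s * (S - W) 1 n s + (S - W) 0 n s * (S - W) 1 n s)
          + ε * ((S - W) 0 n s * (2 * W 0 n s + (S - W) 0 n s))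
          - ((S - W) 0 (n + 1) s * W 1 n s + W 0 (n + 1) s * (S - W) 1 n s + (S - W) 0 (n + 1) s * (S - W) 1 n s)
          - ε * ((S - W) 0 (n + 1) s * (2 * W 0 (n + 1) s + (S - W) 0 (n + 1) s))) := by
  rw [MirrorField.quadTermOn_mirrorTable_bond, MirrorField.quadTermOn_mirrorTable_bond]
  have h2 : (1 + ε₀) ^ ((5 : ℝ) * n / 2) = clock ε₀ n := rfl
  rw [h2]
  simp only [Pi.sub_apply]
  ring

/-- **Bond field difference bound at shell `n ≤ 0`**: with interface levels `|u₀(n)| ≤ R`, `|u₁(n)| ≤ B`, the carrier deviation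
one shell deeper `|u₀(n+1)| ≤ ρ`, templates `|W₀(n)|, |W₁(n)| ≤ M`, `|W₀(n+1)| ≤ M₂`,
`|Q₁,ₙ(S) − Q₁,ₙ(W)| ≤ (M + M₂ + R + ρ)B + (1+2ε)MR + εR² + (M + 2εM₂)ρ + ερ²`.
[cite: Tao2016AveragedNS, §4 (4.8); route TaoLadderRungTwoFlat, L-61b (cell LADDER §61, numT61 §3)] -/
theorem abs_quadTermOn_bond_sub_le {ε₀ ε : ℝ} (hε : 0 ≤ ε) (hε₀ : 0 ≤ ε₀) {S W : Fin 2 → ℤ → ℝ → ℝ} {n : ℤ}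
    (hn : n ≤ 0) {s M M₂ R B ρ : ℝ}
    (hW0 : |W 0 n s| ≤ M) (hW1 : |W 1 n s| ≤ M) (hW0' : |W 0 (n + 1) s| ≤ M₂)
    (hR : |(S - W) 0 n s| ≤ R) (hB : |(S - W) 1 n s| ≤ B) (hρ : |(S - W) 0 (n + 1) s| ≤ ρ) :
    |quadTermOn shiftSetFlat ε₀ (mirrorTable ε ε) S 1 n s - quadTermOn shiftSetFlat ε₀ (mirrorTable ε ε) W 1 n s|
      ≤ (M + M₂ + R + ρ) * B + (1 + 2 * ε) * M * R + ε * R ^ 2 + (M + 2 * ε * M₂) * ρ + ε * ρ ^ 2 := by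
  rw [quadTermOn_bond_sub]
  have hM0 : 0 ≤ M := (abs_nonneg _).trans hW0
  have hR0 : 0 ≤ R := (abs_nonneg _).trans hR
  have hc : clock ε₀ n ≤ 1 := HopTube.clock_le_one_of_nonpos hε₀ hn
  have hc0 : 0 ≤ clock ε₀ n := clock_nonneg (by linarith) _
  have h1 : |(S - W) 0 n s * W 1 n s + W 0 n s * (S - W) 1 n s + (S - W) 0 n s * (S - W) 1 n s|
      ≤ R * M + M * B + R * B := by
    calc _ ≤ |(S - W) 0 n s * W 1 n s + W 0 n s * (S - W) 1 n s| + |(S - W) 0 n s * (S - W) 1 n s| :=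
          abs_add_le _ _
      _ ≤ (|(S - W) 0 n s * W 1 n s| + |W 0 n s * (S - W) 1 n s|) + |(S - W) 0 n s * (S - W) 1 n s| := by
          gcongr; exact abs_add_le _ _
      _ ≤ (R * M + M * B) + R * B := by
          gcongr
          · exact (by rw [abs_mul]; exact mul_le_mul hR hW1 (abs_nonneg _) ((abs_nonneg _).trans hR))
          · exact (by rw [abs_mul]; exact mul_le_mul hW0 hB (abs_nonneg _) ((abs_nonneg _).trans hW0))
          · exact (by rw [abs_mul]; exact mul_le_mul hR hB (abs_nonneg _) ((abs_nonneg _).trans hR))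
  have h2 : |ε * ((S - W) 0 n s * (2 * W 0 n s + (S - W) 0 n s))| ≤ ε * (R * (2 * M + R)) := by
    rw [abs_mul, abs_of_nonneg hε]
    have hq : |2 * W 0 n s + (S - W) 0 n s| ≤ 2 * M + R := by
      calc |2 * W 0 n s + (S - W) 0 n s| ≤ |2 * W 0 n s| + |(S - W) 0 n s| := abs_add_le _ _
        _ ≤ 2 * M + R := by rw [abs_mul, abs_two]; exact add_le_add (by linarith) hR
    refine mul_le_mul_of_nonneg_left ?_ hε
    rw [abs_mul]; exact mul_le_mul hR hq (abs_nonneg _) hR0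
  have h3 : |(S - W) 0 (n + 1) s * W 1 n s + W 0 (n + 1) s * (S - W) 1 n s + (S - W) 0 (n + 1) s * (S - W) 1 n s|
      ≤ ρ * M + M₂ * B + ρ * B := by
    calc _ ≤ |(S - W) 0 (n + 1) s * W 1 n s + W 0 (n + 1) s * (S - W) 1 n s|
            + |(S - W) 0 (n + 1) s * (S - W) 1 n s| := abs_add_le _ _
      _ ≤ (|(S - W) 0 (n + 1) s * W 1 n s| + |W 0 (n + 1) s * (S - W) 1 n s|)
            + |(S - W) 0 (n + 1) s * (S - W) 1 n s| := by gcongr; exact abs_add_le _ _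
      _ ≤ (ρ * M + M₂ * B) + ρ * B := by
          gcongr
          · exact (by rw [abs_mul]; exact mul_le_mul hρ hW1 (abs_nonneg _) ((abs_nonneg _).trans hρ))
          · exact (by rw [abs_mul]; exact mul_le_mul hW0' hB (abs_nonneg _) ((abs_nonneg _).trans hW0'))
          · exact (by rw [abs_mul]; exact mul_le_mul hρ hB (abs_nonneg _) ((abs_nonneg _).trans hρ))
  have h4 : |ε * ((S - W) 0 (n + 1) s * (2 * W 0 (n + 1) s + (S - W) 0 (n + 1) s))| ≤ ε * (ρ * (2 * M₂ + ρ)) := by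
    rw [abs_mul, abs_of_nonneg hε]
    have hq : |2 * W 0 (n + 1) s + (S - W) 0 (n + 1) s| ≤ 2 * M₂ + ρ := by
      calc |2 * W 0 (n + 1) s + (S - W) 0 (n + 1) s| ≤ |2 * W 0 (n + 1) s| + |(S - W) 0 (n + 1) s| := abs_add_le _ _
        _ ≤ 2 * M₂ + ρ := by rw [abs_mul, abs_two]; exact add_le_add (by linarith) hρ
    refine mul_le_mul_of_nonneg_left ?_ hε
    rw [abs_mul]; exact mul_le_mul hρ hq (abs_nonneg _) ((abs_nonneg _).trans hρ)
  set Z := ((S - W) 0 n s * W 1 n s + W 0 n s * (S - W) 1 n s + (S - W) 0 n s * (S - W) 1 n s)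
      + ε * ((S - W) 0 n s * (2 * W 0 n s + (S - W) 0 n s))
      - ((S - W) 0 (n + 1) s * W 1 n s + W 0 (n + 1) s * (S - W) 1 n s + (S - W) 0 (n + 1) s * (S - W) 1 n s)
      - ε * ((S - W) 0 (n + 1) s * (2 * W 0 (n + 1) s + (S - W) 0 (n + 1) s)) with hZ
  have hZle : |Z| ≤ (R * M + M * B + R * B) + ε * (R * (2 * M + R)) + (ρ * M + M₂ * B + ρ * B)
      + ε * (ρ * (2 * M₂ + ρ)) := by
    calc |Z| ≤ |((S - W) 0 n s * W 1 n s + W 0 n s * (S - W) 1 n s + (S - W) 0 n s * (S - W) 1 n s)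
              + ε * ((S - W) 0 n s * (2 * W 0 n s + (S - W) 0 n s))
              - ((S - W) 0 (n + 1) s * W 1 n s + W 0 (n + 1) s * (S - W) 1 n s
                + (S - W) 0 (n + 1) s * (S - W) 1 n s)|
            + |ε * ((S - W) 0 (n + 1) s * (2 * W 0 (n + 1) s + (S - W) 0 (n + 1) s))| := abs_sub _ _
      _ ≤ (|((S - W) 0 n s * W 1 n s + W 0 n s * (S - W) 1 n s + (S - W) 0 n s * (S - W) 1 n s)
              + ε * ((S - W) 0 n s * (2 * W 0 n s + (S - W) 0 n s))|
            + |(S - W) 0 (n + 1) s * W 1 n s + W 0 (n + 1) s * (S - W) 1 n s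
                + (S - W) 0 (n + 1) s * (S - W) 1 n s|)
            + |ε * ((S - W) 0 (n + 1) s * (2 * W 0 (n + 1) s + (S - W) 0 (n + 1) s))| := by
          gcongr; exact abs_sub _ _
      _ ≤ ((|(S - W) 0 n s * W 1 n s + W 0 n s * (S - W) 1 n s + (S - W) 0 n s * (S - W) 1 n s|
              + |ε * ((S - W) 0 n s * (2 * W 0 n s + (S - W) 0 n s))|)
            + |(S - W) 0 (n + 1) s * W 1 n s + W 0 (n + 1) s * (S - W) 1 n s
                + (S - W) 0 (n + 1) s * (S - W) 1 n s|)
            + |ε * ((S - W) 0 (n + 1) s * (2 * W 0 (n + 1) s + (S - W) 0 (n + 1) s))| := by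
          gcongr; exact abs_add_le _ _
      _ ≤ ((R * M + M * B + R * B) + ε * (R * (2 * M + R))) + (ρ * M + M₂ * B + ρ * B)
            + ε * (ρ * (2 * M₂ + ρ)) := by gcongr
  have hZ0 : 0 ≤ |Z| := abs_nonneg _
  calc |clock ε₀ n * Z| = clock ε₀ n * |Z| := by rw [abs_mul, abs_of_nonneg hc0]
    _ ≤ 1 * |Z| := mul_le_mul_of_nonneg_right hc hZ0
    _ ≤ _ := by rw [one_mul]; refine hZle.trans (le_of_eq ?_); ring

/-! ### The near block's edge input with the top bond read from the near LEVEL (theory-1 D16) -/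

/-- **EDGE INPUT, LEVEL-FED TOP.** As `edgeInput_le`, but the top bond deviation `q_P` is bounded by a level `ν` whose co-moving
weight compensates its growth, `e^{θ(P − n_e)}·ν² ≤ 2V̄` (this is what the co-moving near energy `≤ V̄` gives at the top near
shell): the top summand becomes `c̄·r·(2V̄ + ε·r·√(2V̄) + (1+ε)·M·r)` — no block amplitude `A`, no `e^{θ}` (TRAP #20 cure).
[cite: Tao2016AveragedNS, §4 (4.3) (local energy identity, statement shape); route TaoLadderRungTwoFlat, L8b-1 E1/E2 + D16 (cell LADDER §49.3, §60.7, §61)] -/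
theorem edgeInput_le_level {ε ε₀ θ ne A M cbar r ν Vbar : ℝ} (hε : 0 ≤ ε) (hε₀ : -1 ≤ ε₀) (hθ : 0 ≤ θ)
    (hM : 0 ≤ M) (hcbar1 : 0 ≤ cbar)
    {a P : ℤ} (u : Fin 2 → ℤ → ℝ → ℝ) (t : ℝ) (hPne : (P : ℝ) ≤ ne)
    (hqa : |u 1 (a - 1) t| ≤ A) (hpa : |u 0 a t| ≤ A) (hqP : |u 1 P t| ≤ ν)
    (hν : Real.exp (θ * ((P : ℝ) - ne)) * ν ^ 2 ≤ 2 * Vbar) (hr : |u 0 (P + 1) t| ≤ r)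
    (hca : clock ε₀ (a - 1) ≤ cbar) (hcP : clock ε₀ P ≤ cbar) :
    Real.exp (θ * ((a : ℝ) - ne)) * |fluxT ε ε₀ u (a - 1) t| + Real.exp (θ * ((P : ℝ) - ne)) * |fluxT ε ε₀ u P t|
        + (1 + ε) * cbar * M * (Real.exp (θ * ((a : ℝ) - ne)) * u 1 (a - 1) t ^ 2
            + Real.exp (θ * ((P : ℝ) - ne)) * u 0 (P + 1) t ^ 2)
      ≤ Real.exp (θ * ((a : ℝ) - ne)) * ((1 + ε) * cbar * A ^ 2 * (A + M))
        + cbar * r * (2 * Vbar + ε * r * Real.sqrt (2 * Vbar) + (1 + ε) * M * r) := by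
  set φa := Real.exp (θ * ((a : ℝ) - ne)) with hφa
  set φP := Real.exp (θ * ((P : ℝ) - ne)) with hφP
  have hφa0 : 0 ≤ φa := (Real.exp_pos _).le
  have hφP0 : 0 ≤ φP := (Real.exp_pos _).le
  have hφP1 : φP ≤ 1 := by
    rw [hφP, Real.exp_le_one_iff]; exact mul_nonpos_of_nonneg_of_nonpos hθ (by linarith)
  have hA0 : 0 ≤ A := (abs_nonneg _).trans hqa
  have hr0 : 0 ≤ r := (abs_nonneg _).trans hr
  have hν0 : 0 ≤ ν := (abs_nonneg _).trans hqP
  have hca0 : 0 ≤ clock ε₀ (a - 1) := clock_nonneg hε₀ _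
  have hcP0 : 0 ≤ clock ε₀ P := clock_nonneg hε₀ _
  have hV0 : 0 ≤ 2 * Vbar := le_trans (by positivity) hν
  -- bottom bond: |T_{a-1}| ≤ c̄(1+ε)A·A·A
  have hpa' : |u 0 (a - 1 + 1) t| ≤ A := by rw [sub_add_cancel]; exact hpa
  have hTa := abs_fluxT_le hε hε₀ u (a - 1) t hqa hpa'
  have hTa' : |fluxT ε ε₀ u (a - 1) t| ≤ cbar * ((1 + ε) * A) * (A * A) := by
    refine hTa.trans ?_
    have h1 : |u 1 (a - 1) t| * |u 0 (a - 1 + 1) t| ≤ A * A := mul_le_mul hqa hpa' (abs_nonneg _) hA0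
    have h2 : 0 ≤ (1 + ε) * A := by positivity
    calc clock ε₀ (a - 1) * ((1 + ε) * A) * (|u 1 (a - 1) t| * |u 0 (a - 1 + 1) t|)
        ≤ clock ε₀ (a - 1) * ((1 + ε) * A) * (A * A) := mul_le_mul_of_nonneg_left h1 (mul_nonneg hca0 h2)
      _ ≤ cbar * ((1 + ε) * A) * (A * A) := by gcongr
  -- top bond, read from the level: |T_P| ≤ c̄·ν·r·(ν + ε r)
  have hTP : |fluxT ε ε₀ u P t| ≤ cbar * (ν * r * (ν + ε * r)) := by
    unfold fluxT
    rw [abs_mul, abs_mul, abs_mul, abs_of_nonneg hcP0]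
    have h3 : |u 1 P t + ε * u 0 (P + 1) t| ≤ ν + ε * r := by
      calc |u 1 P t + ε * u 0 (P + 1) t| ≤ |u 1 P t| + |ε * u 0 (P + 1) t| := abs_add_le _ _
        _ = |u 1 P t| + ε * |u 0 (P + 1) t| := by rw [abs_mul, abs_of_nonneg hε]
        _ ≤ ν + ε * r := add_le_add hqP (mul_le_mul_of_nonneg_left hr hε)
    have h12 : |u 1 P t| * |u 0 (P + 1) t| ≤ ν * r := mul_le_mul hqP hr (abs_nonneg _) hν0
    calc clock ε₀ P * |u 1 P t| * |u 0 (P + 1) t| * |u 1 P t + ε * u 0 (P + 1) t|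
        = clock ε₀ P * ((|u 1 P t| * |u 0 (P + 1) t|) * |u 1 P t + ε * u 0 (P + 1) t|) := by ring
      _ ≤ cbar * ((ν * r) * (ν + ε * r)) := by
          refine mul_le_mul hcP (mul_le_mul h12 h3 (abs_nonneg _) (by positivity)) (by positivity) hcbar1
      _ = cbar * (ν * r * (ν + ε * r)) := by ring
  -- the weighted top level: φP·ν² ≤ 2V̄ and φP·ν ≤ √(2V̄)
  have hφν : φP * ν ≤ Real.sqrt (2 * Vbar) := by
    have hsq : (φP * ν) ^ 2 ≤ 2 * Vbar := by
      calc (φP * ν) ^ 2 = φP * (φP * ν ^ 2) := by ring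
        _ ≤ 1 * (2 * Vbar) := mul_le_mul hφP1 hν (by positivity) zero_le_one
        _ = 2 * Vbar := one_mul _
    exact (le_abs_self _).trans (Real.abs_le_sqrt hsq)
  -- squares
  have hqa2 : u 1 (a - 1) t ^ 2 ≤ A ^ 2 := by
    have := hqa; rw [← sq_abs]; exact pow_le_pow_left₀ (abs_nonneg _) this 2
  have hr2 : u 0 (P + 1) t ^ 2 ≤ r ^ 2 := by
    rw [← sq_abs]; exact pow_le_pow_left₀ (abs_nonneg _) hr 2
  have hMε : 0 ≤ (1 + ε) * cbar * M := by positivity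
  -- assemble
  have e1 : φa * |fluxT ε ε₀ u (a - 1) t| ≤ φa * (cbar * ((1 + ε) * A) * (A * A)) :=
    mul_le_mul_of_nonneg_left hTa' hφa0
  have e2 : φP * |fluxT ε ε₀ u P t| ≤ cbar * r * (2 * Vbar + ε * r * Real.sqrt (2 * Vbar)) := by
    calc φP * |fluxT ε ε₀ u P t| ≤ φP * (cbar * (ν * r * (ν + ε * r))) := mul_le_mul_of_nonneg_left hTP hφP0
      _ = cbar * r * (φP * ν ^ 2 + ε * r * (φP * ν)) := by ring
      _ ≤ cbar * r * (2 * Vbar + ε * r * Real.sqrt (2 * Vbar)) := by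
          refine mul_le_mul_of_nonneg_left (add_le_add hν ?_) (mul_nonneg hcbar1 hr0)
          exact mul_le_mul_of_nonneg_left hφν (by positivity)
  have e3 : (1 + ε) * cbar * M * (φa * u 1 (a - 1) t ^ 2 + φP * u 0 (P + 1) t ^ 2)
      ≤ (1 + ε) * cbar * M * (φa * A ^ 2 + 1 * r ^ 2) := by
    refine mul_le_mul_of_nonneg_left (add_le_add (mul_le_mul_of_nonneg_left hqa2 hφa0) ?_) hMε
    exact mul_le_mul hφP1 hr2 (by positivity) zero_le_one
  calc φa * |fluxT ε ε₀ u (a - 1) t| + φP * |fluxT ε ε₀ u P t|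
        + (1 + ε) * cbar * M * (φa * u 1 (a - 1) t ^ 2 + φP * u 0 (P + 1) t ^ 2)
      ≤ φa * (cbar * ((1 + ε) * A) * (A * A)) + cbar * r * (2 * Vbar + ε * r * Real.sqrt (2 * Vbar))
        + (1 + ε) * cbar * M * (φa * A ^ 2 + 1 * r ^ 2) := add_le_add (add_le_add e1 e2) e3
    _ = φa * ((1 + ε) * cbar * A ^ 2 * (A + M))
        + cbar * r * (2 * Vbar + ε * r * Real.sqrt (2 * Vbar) + (1 + ε) * M * r) := by ring

end MirrorPulse

end Summit.NavierStokesRegularity.NavierStokesRegularity.Theorems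

end
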